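import Mathlib
import Summits.MatrixMultiplication.MatrixMultiplication.Theorems.FidelityWitnessesDiagonalPowerDecayKoszulWitnessFlattening

/-!
# Koszul witness for `DiagonalPowerDecay` (stmt-MatrixMultiplication-14053), part 3: the spectral bound

The SPECTRAL BOUND for the flattened matrix multiplication tensor `K_w = kwM Φ_w ⟨n,n,n⟩`
(`Φ_w = kwProj w`, parts 1–2): for every orthonormal family `f₁,…,f_m` of row vectors,

  `∑_j ‖K_wᵀ f̄_j‖² ≤ m + 3n² + n·(n % 2)`        (`kwM_matMul_bessel`).

Mechanism.  By part 2 the left side is `∑_j ∑_μ ∑_κ ∑_i |G₀(f_j; i,κ,μ)|²` (the twirl acts unitarily on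
columns), and `G₀` has the closed forms `kwG0_mid` / `kwG0_gen` (coefficient patterns `β` of part 1: an
anticommuting Pauli pair `(P_rev, D)` on the `Fin.rev`-orbits of size two, `√3` on the fixed point).  On an
orbit `{κ, rev κ}` the untwirled flattening `J` satisfies `J Jᵀ = 1 + 3 V Vᵀ` with `V` of orthonormal
columns `v_κ = (e₂κ − d_κ e₁(rev κ) − d_κ e₀κ)/√3` (`kw_orbit_identity`, `kw_spectral_identity`: the
flattening of `⟨n,n,n⟩` has singular values² `4` with multiplicity `n²` and `1` with multiplicity `2n²`
for even `n`), and `J Jᵀ = 3·diag(0,1,1)` on the fixed point (odd `n`); Bessel's inequality for the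
`f_j` against the unit vectors `v_κ ⊗ e_μ` (`kwV`, `norm_kwV`) and the coordinate vectors gives the bound
(`5/6` of the trivial `tr K Kᵀ = 6n²` at `m = 2n²`).

References: J. M. Landsberg, G. Ottaviani, Theory of Computing 11 (2015); folklore (Bessel's inequality).
-/

set_option linter.dupNamespace false

noncomputable section

namespace Summit.MatrixMultiplication.MatrixMultiplication.Theorems.DiagonalPowerDecay

open scoped BigOperators ComplexConjugate InnerProductSpace
open Literature.Computability.AlgebraicComplexity

section MatMul

variable {n : ℕ}

/-! ### The untwirled flattening `K_0`: closed forms of the row functional -/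

/-- `∑_ν h(ν) β₀(κ,ν) = h(κ)·(√3 or 1)`. [folklore] -/
theorem sum_mul_kwBeta_zero (h : Fin n → ℂ) (κ : Fin n) :
    ∑ ν, h ν * kwBeta κ ν 0 = h κ * (if κ.rev = κ then ((Real.sqrt 3 : ℝ) : ℂ) else 1) := by
  classical
  simp only [kwBeta_zero]
  rw [Finset.sum_eq_single κ]
  · rw [if_pos rfl]
  · intro ν _ hν; rw [if_neg (Ne.symm hν), mul_zero]
  · intro hκ; exact absurd (Finset.mem_univ κ) hκ

/-- `∑_ν h(ν) β₁(κ,ν) = [rev κ ≠ κ]·h(rev κ)`. [folklore] -/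
theorem sum_mul_kwBeta_one (h : Fin n → ℂ) (κ : Fin n) :
    ∑ ν, h ν * kwBeta κ ν 1 = if κ.rev = κ then 0 else h κ.rev := by
  classical
  simp only [kwBeta_one]
  rw [Finset.sum_eq_single κ.rev]
  · by_cases hr : κ.rev = κ
    · rw [if_pos hr, if_neg]; · simp
      exact fun h' => h'.2 hr
    · rw [if_neg hr, if_pos ⟨rfl, hr⟩, mul_one]
  · intro ν _ hν
    rw [if_neg]; · simp
    exact fun h' => hν h'.1
  · intro hκ; exact absurd (Finset.mem_univ _) hκ

/-- `∑_ν h(ν) β₂(κ,ν) = [rev κ ≠ κ]·d_κ h(κ)`. [folklore] -/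
theorem sum_mul_kwBeta_two (h : Fin n → ℂ) (κ : Fin n) :
    ∑ ν, h ν * kwBeta κ ν 2 = if κ.rev = κ then 0 else h κ * kwSgn κ := by
  classical
  simp only [kwBeta_two]
  rw [Finset.sum_eq_single κ]
  · by_cases hr : κ.rev = κ
    · rw [if_pos hr, if_neg]; · simp
      exact fun h' => h'.2 hr
    · rw [if_neg hr, if_pos ⟨rfl, hr⟩]
  · intro ν _ hν
    rw [if_neg]; · simp
    exact fun h' => hν h'.1.symm
  · intro hκ; exact absurd (Finset.mem_univ _) hκ

/-- `G₀` with the sum over `j` outside and the sums over `ν` evaluated. [folklore] -/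
theorem kwG0_eq (f : Fin 3 × (Fin n × Fin n) → ℂ) (i : Fin 3) (κ μ : Fin n) :
    kwG0 f i κ μ =
      kwTab (fun p => f (p, (μ, κ))) i 0 * (if κ.rev = κ then ((Real.sqrt 3 : ℝ) : ℂ) else 1) +
      (if κ.rev = κ then 0 else kwTab (fun p => f (p, (μ, κ.rev))) i 1) +
      (if κ.rev = κ then 0 else kwTab (fun p => f (p, (μ, κ))) i 2 * kwSgn κ) := by
  unfold kwG0
  rw [Finset.sum_comm, Fin.sum_univ_three, sum_mul_kwBeta_zero (fun ν => kwTab (fun p => f (p, (μ, ν))) i 0),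
    sum_mul_kwBeta_one (fun ν => kwTab (fun p => f (p, (μ, ν))) i 1),
    sum_mul_kwBeta_two (fun ν => kwTab (fun p => f (p, (μ, ν))) i 2)]

/-- `G₀` on the fixed point of `rev` (odd `n`, middle index): `(0, √3 f̄₂, √3 f̄₁)`. [folklore] -/
theorem kwG0_mid (f : Fin 3 × (Fin n × Fin n) → ℂ) (κ μ : Fin n) (h : κ.rev = κ) :
    kwG0 f 0 κ μ = 0 ∧
    kwG0 f 1 κ μ = ((Real.sqrt 3 : ℝ) : ℂ) * conj (f (2, (μ, κ))) ∧
    kwG0 f 2 κ μ = ((Real.sqrt 3 : ℝ) : ℂ) * conj (f (1, (μ, κ))) := by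
  refine ⟨?_, ?_, ?_⟩ <;>
  · rw [kwG0_eq]
    simp [h, kwTab, Matrix.cons_val_zero, Matrix.cons_val_one, Matrix.cons_val_two, mul_comm]

/-- `G₀` off the fixed point: `(-f̄₂' - d f̄₁, f̄₂ - d f̄₀, f̄₁ + f̄₀')` (primes = values at `rev κ`).
[folklore] -/
theorem kwG0_gen (f : Fin 3 × (Fin n × Fin n) → ℂ) (κ μ : Fin n) (h : κ.rev ≠ κ) :
    kwG0 f 0 κ μ = -conj (f (2, (μ, κ.rev))) - kwSgn κ * conj (f (1, (μ, κ))) ∧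
    kwG0 f 1 κ μ = conj (f (2, (μ, κ))) - kwSgn κ * conj (f (0, (μ, κ))) ∧
    kwG0 f 2 κ μ = conj (f (1, (μ, κ))) + conj (f (0, (μ, κ.rev))) := by
  refine ⟨?_, ?_, ?_⟩
  · rw [kwG0_eq]
    simp [h, kwTab, Matrix.cons_val_zero, Matrix.cons_val_one, Matrix.cons_val_two]
    ring
  · rw [kwG0_eq]
    simp [h, kwTab, Matrix.cons_val_zero, Matrix.cons_val_one, Matrix.cons_val_two]
    ring
  · rw [kwG0_eq]
    simp [h, kwTab, Matrix.cons_val_zero, Matrix.cons_val_one, Matrix.cons_val_two]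

/-- `((‖z‖ : ℝ) : ℂ)² = z · conj z`. [folklore] -/
theorem ofReal_norm_sq_eq (z : ℂ) : ((‖z‖ : ℝ) : ℂ) ^ 2 = z * conj z := by
  rw [Complex.mul_conj']

/-- The polynomial identity behind `J Jᵀ = 1 + 3 V Vᵀ` on a `rev`-orbit `{κ, rev κ}` of size two
(`a,b,c` = `f₀,f₁,f₂` at `κ`, primes at `rev κ`, `d = d_κ = -d_{rev κ}`):
the squared column functionals of the orbit block sum to `‖f‖²_block + |c - d b' - d a|² + |c' + d b + d a'|²`.
[folklore] -/
theorem kw_orbit_identity (a b c a' b' c' d : ℂ) (hd : d = 1 ∨ d = -1) :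
    (‖-conj c' - d * conj b‖ ^ 2 + ‖conj c - d * conj a‖ ^ 2 + ‖conj b + conj a'‖ ^ 2) +
      (‖-conj c - (-d) * conj b'‖ ^ 2 + ‖conj c' - (-d) * conj a'‖ ^ 2 + ‖conj b' + conj a‖ ^ 2) =
    (‖a‖ ^ 2 + ‖b‖ ^ 2 + ‖c‖ ^ 2 + ‖c - d * b' - d * a‖ ^ 2) +
      (‖a'‖ ^ 2 + ‖b'‖ ^ 2 + ‖c'‖ ^ 2 + ‖c' - (-d) * b - (-d) * a'‖ ^ 2) := by
  apply Complex.ofReal_injective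
  push_cast
  simp only [ofReal_norm_sq_eq, map_add, map_sub, map_neg, map_mul, Complex.conj_conj]
  rcases hd with rfl | rfl
  · simp only [map_one]; ring
  · simp only [map_neg, map_one]; ring

/-- The right-hand side of the spectral identity, per index `κ` (for fixed `μ`):
`3(|f₁|² + |f₂|²)` on the fixed point, `|f₀|² + |f₁|² + |f₂|² + |f₂ - d f₁' - d f₀|²` off it. [folklore] -/
def kwR (f : Fin 3 × (Fin n × Fin n) → ℂ) (μ κ : Fin n) : ℝ :=
  if κ.rev = κ then 3 * (‖f (1, (μ, κ))‖ ^ 2 + ‖f (2, (μ, κ))‖ ^ 2)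
  else ‖f (0, (μ, κ))‖ ^ 2 + ‖f (1, (μ, κ))‖ ^ 2 + ‖f (2, (μ, κ))‖ ^ 2 +
    ‖f (2, (μ, κ)) - kwSgn κ * f (1, (μ, κ.rev)) - kwSgn κ * f (0, (μ, κ))‖ ^ 2

/-- `d_κ = 1 ∨ d_κ = -1`. [folklore] -/
theorem kwSgn_eq_or (κ : Fin n) : kwSgn κ = 1 ∨ kwSgn κ = -1 := by
  unfold kwSgn; split_ifs <;> simp

/-- **The spectral identity for `K_0`** (one `μ`-slice): `∑_κ ∑_i |G₀(f;i,κ,μ)|² = ∑_κ kwR f μ κ`,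
i.e. `‖K_0ᵀ f̄‖² = ‖f‖²_{off} + 3 ∑ |⟨v_{κμ}, f⟩|² + 3 ∑_{mid} (|f₁|² + |f₂|²)`. Proof: symmetrise over
`κ ↦ rev κ` and use `kw_orbit_identity` on each orbit. [folklore] -/
theorem kw_spectral_identity (f : Fin 3 × (Fin n × Fin n) → ℂ) (μ : Fin n) :
    ∑ κ : Fin n, ∑ i : Fin 3, ‖kwG0 f i κ μ‖ ^ 2 = ∑ κ : Fin n, kwR f μ κ := by
  -- pointwise on orbits
  have key : ∀ κ : Fin n, (∑ i : Fin 3, ‖kwG0 f i κ μ‖ ^ 2) + (∑ i : Fin 3, ‖kwG0 f i κ.rev μ‖ ^ 2) =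
      kwR f μ κ + kwR f μ κ.rev := by
    intro κ
    by_cases h : κ.rev = κ
    · rw [h]
      obtain ⟨h0, h1, h2⟩ := kwG0_mid f κ μ h
      have hs : ‖((Real.sqrt 3 : ℝ) : ℂ)‖ ^ 2 = 3 := by
        rw [Complex.norm_real, Real.norm_of_nonneg (Real.sqrt_nonneg _), Real.sq_sqrt]
        norm_num
      rw [Fin.sum_univ_three, h0, h1, h2, kwR, if_pos h, norm_zero, norm_mul, norm_mul, mul_pow,
        mul_pow, hs, Complex.norm_conj, Complex.norm_conj]
      ring
    · have h' : κ.rev.rev ≠ κ.rev := by rw [Fin.rev_rev]; exact Ne.symm h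
      obtain ⟨h0, h1, h2⟩ := kwG0_gen f κ μ h
      obtain ⟨h0', h1', h2'⟩ := kwG0_gen f κ.rev μ h'
      rw [Fin.sum_univ_three, Fin.sum_univ_three, h0, h1, h2, h0', h1', h2', kwR, kwR, if_neg h, if_neg h',
        kwSgn_rev h, Fin.rev_rev]
      exact kw_orbit_identity _ _ _ _ _ _ _ (kwSgn_eq_or κ)
  -- symmetrise
  have hsymL : ∑ κ : Fin n, ∑ i : Fin 3, ‖kwG0 f i κ.rev μ‖ ^ 2 = ∑ κ : Fin n, ∑ i : Fin 3, ‖kwG0 f i κ μ‖ ^ 2 :=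
    Fintype.sum_equiv Fin.revPerm _ _ fun _ => rfl
  have hsymR : ∑ κ : Fin n, kwR f μ κ.rev = ∑ κ : Fin n, kwR f μ κ :=
    Fintype.sum_equiv Fin.revPerm _ _ fun _ => rfl
  have h2 : 2 * ∑ κ : Fin n, ∑ i : Fin 3, ‖kwG0 f i κ μ‖ ^ 2 = 2 * ∑ κ : Fin n, kwR f μ κ := by
    calc 2 * ∑ κ : Fin n, ∑ i : Fin 3, ‖kwG0 f i κ μ‖ ^ 2
        = ∑ κ : Fin n, ∑ i : Fin 3, ‖kwG0 f i κ μ‖ ^ 2 + ∑ κ : Fin n, ∑ i : Fin 3, ‖kwG0 f i κ.rev μ‖ ^ 2 := by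
          rw [two_mul, hsymL]
      _ = ∑ κ : Fin n, (kwR f μ κ + kwR f μ κ.rev) := by
          rw [← Finset.sum_add_distrib]
          exact Finset.sum_congr rfl fun κ _ => key κ
      _ = 2 * ∑ κ : Fin n, kwR f μ κ := by
          rw [Finset.sum_add_distrib, hsymR, two_mul]
  linarith

/-! ### The unit vectors `v_{κμ}` and the Bessel bound -/

/-- The unit vector `v_{κμ} = (e_{(2,(μ,κ))} - d_κ e_{(1,(μ,rev κ))} - d_κ e_{(0,(μ,κ))})/√3` (a top singular
vector of the untwirled flattening `K_0`). [folklore] -/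
def kwV (κ μ : Fin n) : EuclideanSpace ℂ (Fin 3 × (Fin n × Fin n)) :=
  WithLp.toLp 2 fun r =>
    (((Real.sqrt 3)⁻¹ : ℝ) : ℂ) * ((if r = (2, (μ, κ)) then 1 else 0) -
      kwSgn κ * (if r = (1, (μ, κ.rev)) then 1 else 0) - kwSgn κ * (if r = (0, (μ, κ)) then 1 else 0))

/-- Coordinates of `v_{κμ}`. [folklore] -/
theorem kwV_apply (κ μ : Fin n) (r : Fin 3 × (Fin n × Fin n)) :
    kwV κ μ r = (((Real.sqrt 3)⁻¹ : ℝ) : ℂ) * ((if r = (2, (μ, κ)) then 1 else 0) -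
      kwSgn κ * (if r = (1, (μ, κ.rev)) then 1 else 0) - kwSgn κ * (if r = (0, (μ, κ)) then 1 else 0)) := rfl

/-- `⟨v_{κμ}, f⟩ = (f(2,(μ,κ)) - d_κ f(1,(μ,rev κ)) - d_κ f(0,(μ,κ)))/√3`. [folklore] -/
theorem inner_kwV (κ μ : Fin n) (f : EuclideanSpace ℂ (Fin 3 × (Fin n × Fin n))) :
    ⟪kwV κ μ, f⟫_ℂ = (((Real.sqrt 3)⁻¹ : ℝ) : ℂ) *
      (f (2, (μ, κ)) - kwSgn κ * f (1, (μ, κ.rev)) - kwSgn κ * f (0, (μ, κ))) := by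
  classical
  rw [PiLp.inner_apply]
  simp only [RCLike.inner_apply, kwV_apply, map_mul, map_sub, Complex.conj_ofReal, conj_kwSgn,
    apply_ite conj, map_one, map_zero]
  simp only [mul_sub, Finset.sum_sub_distrib, mul_ite, mul_one, mul_zero]
  simp only [Finset.sum_ite_eq', Finset.mem_univ, if_true]
  ring

/-- `‖v_{κμ}‖ = 1`. [folklore] -/
theorem norm_kwV (κ μ : Fin n) : ‖kwV κ μ‖ = 1 := by
  have h2 : ((2 : Fin 3), (μ, κ)) ≠ ((1 : Fin 3), (μ, κ.rev)) := by simp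
  have h2' : ((2 : Fin 3), (μ, κ)) ≠ ((0 : Fin 3), (μ, κ)) := by simp
  have h1 : ((1 : Fin 3), (μ, κ.rev)) ≠ ((2 : Fin 3), (μ, κ)) := by simp
  have h1' : ((1 : Fin 3), (μ, κ.rev)) ≠ ((0 : Fin 3), (μ, κ)) := by simp
  have h0 : ((0 : Fin 3), (μ, κ)) ≠ ((2 : Fin 3), (μ, κ)) := by simp
  have h0' : ((0 : Fin 3), (μ, κ)) ≠ ((1 : Fin 3), (μ, κ.rev)) := by simp
  have hinner : ⟪kwV κ μ, kwV κ μ⟫_ℂ = 1 := by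
    rw [inner_kwV, kwV_apply, kwV_apply, kwV_apply]
    simp only [if_true, if_neg h2, if_neg h2', if_neg h1, if_neg h1', if_neg h0, if_neg h0']
    have hd := kwSgn_mul_self κ
    have h3 : ((((Real.sqrt 3)⁻¹ : ℝ) : ℂ)) * (((Real.sqrt 3)⁻¹ : ℝ) : ℂ) * 3 = 1 := by
      rw [← Complex.ofReal_mul, ← mul_inv, Real.mul_self_sqrt (by norm_num : (0:ℝ) ≤ 3)]
      push_cast
      norm_num
    linear_combination (((Real.sqrt 3)⁻¹ : ℝ) : ℂ) * (((Real.sqrt 3)⁻¹ : ℝ) : ℂ) * 2 * hd + h3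
  have := @inner_self_eq_norm_sq ℂ _ _ _ _ (kwV κ μ)
  rw [hinner] at this
  have h : ‖kwV κ μ‖ ^ 2 = 1 := by exact_mod_cast this.symm
  nlinarith [norm_nonneg (kwV κ μ)]

/-- Pointwise bound on `kwR`: off the fixed point `kwR = ∑_p |f_p|² + 3 |⟨v_{κμ}, f⟩|²`, on it
`kwR = 3(|f₁|² + |f₂|²) ≤ ∑_p |f_p|² + 2(|f₁|² + |f₂|²)`. [folklore] -/
theorem kwR_le (f : EuclideanSpace ℂ (Fin 3 × (Fin n × Fin n))) (μ κ : Fin n) :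
    kwR f μ κ ≤ (‖f (0, (μ, κ))‖ ^ 2 + ‖f (1, (μ, κ))‖ ^ 2 + ‖f (2, (μ, κ))‖ ^ 2) +
      (if κ.rev = κ then 2 * (‖f (1, (μ, κ))‖ ^ 2 + ‖f (2, (μ, κ))‖ ^ 2)
        else 3 * ‖⟪kwV κ μ, f⟫_ℂ‖ ^ 2) := by
  unfold kwR
  split_ifs with h
  · nlinarith [sq_nonneg ‖f (0, (μ, κ))‖]
  · rw [inner_kwV, norm_mul, mul_pow, Complex.norm_real, Real.norm_of_nonneg (by positivity),
      inv_pow, Real.sq_sqrt (by norm_num : (0:ℝ) ≤ 3)]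
    have : (3 : ℝ) * (3⁻¹ * ‖f (2, (μ, κ)) - kwSgn κ * f (1, (μ, κ.rev)) - kwSgn κ * f (0, (μ, κ))‖ ^ 2) =
        ‖f (2, (μ, κ)) - kwSgn κ * f (1, (μ, κ.rev)) - kwSgn κ * f (0, (μ, κ))‖ ^ 2 := by ring
    rw [this]

/-- The number of fixed points of `Fin.rev` on `Fin n` is `n % 2`. [folklore] -/
theorem card_filter_rev_eq (n : ℕ) :
    (Finset.univ.filter fun κ : Fin n => κ.rev = κ).card = n % 2 := by
  rcases Nat.even_or_odd n with ⟨k, rfl⟩ | ⟨k, rfl⟩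
  · have : (Finset.univ.filter fun κ : Fin (k + k) => κ.rev = κ) = ∅ := by
      ext κ
      simp only [Finset.mem_filter, Finset.mem_univ, true_and, Finset.notMem_empty, iff_false]
      intro h
      have := congrArg Fin.val h
      rw [Fin.val_rev] at this
      omega
    rw [this, Finset.card_empty]; omega
  · have hk : k < 2 * k + 1 := by omega
    have : (Finset.univ.filter fun κ : Fin (2 * k + 1) => κ.rev = κ) = {⟨k, hk⟩} := by
      ext κ
      simp only [Finset.mem_filter, Finset.mem_univ, true_and, Finset.mem_singleton, Fin.ext_iff,
        Fin.val_rev]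
      omega
    rw [this, Finset.card_singleton]; omega

/-- **Spectral (Bessel) bound for the twirled flattenings of `⟨n,n,n⟩`**: for every orthonormal family
`f₁, …, f_m` of row vectors and every twirl index `w`,
`∑_j ‖(kwM Φ_w ⟨n,n,n⟩)ᵀ f̄_j‖² ≤ m + 3n² + n·(n % 2)` — the sum of the top `m` eigenvalues of `K Kᵀ`
(`1 + 3E`, `rank E = n²`, plus `3·diag(0,1,1)` on the middle index for odd `n`). [folklore] -/
theorem kwM_matMul_bessel {n : ℕ} [NeZero n] (w : Fin n × Fin n) {m : ℕ}
    (f : Fin m → EuclideanSpace ℂ (Fin 3 × (Fin n × Fin n))) (hf : Orthonormal ℂ f) :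
    ∑ j, ∑ q : Fin 3 × (Fin n × Fin n),
        ‖∑ r : Fin 3 × (Fin n × Fin n), conj (f j r) * kwM (kwProj w) (matMulTensor ℂ n n n) r q‖ ^ 2 ≤
      (m : ℝ) + 3 * (n : ℝ) ^ 2 + (n : ℝ) * (n % 2 : ℕ) := by
  classical
  -- per vector: reduce to `kwR` and bound pointwise
  have hper : ∀ j, ∑ q : Fin 3 × (Fin n × Fin n),
      ‖∑ r : Fin 3 × (Fin n × Fin n), conj (f j r) * kwM (kwProj w) (matMulTensor ℂ n n n) r q‖ ^ 2 ≤
      1 + ∑ μ : Fin n, ∑ κ : Fin n, (if κ.rev = κ then 2 * (‖f j (1, (μ, κ))‖ ^ 2 + ‖f j (2, (μ, κ))‖ ^ 2)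
        else 3 * ‖⟪kwV κ μ, f j⟫_ℂ‖ ^ 2) := by
    intro j
    -- reindex the columns `q = (i, (κ, μ))` and apply the twirl reduction in `κ`
    have e1 : ∑ q : Fin 3 × (Fin n × Fin n),
        ‖∑ r : Fin 3 × (Fin n × Fin n), conj (f j r) * kwM (kwProj w) (matMulTensor ℂ n n n) r q‖ ^ 2 =
        ∑ μ : Fin n, ∑ κ : Fin n, ∑ i : Fin 3, ‖kwG0 (f j) i κ μ‖ ^ 2 := by
      rw [Fintype.sum_prod_type]
      have : ∀ i : Fin 3, ∑ b : Fin n × Fin n,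
          ‖∑ r : Fin 3 × (Fin n × Fin n), conj (f j r) * kwM (kwProj w) (matMulTensor ℂ n n n) r (i, b)‖ ^ 2 =
          ∑ μ : Fin n, ∑ κ : Fin n, ‖kwG0 (f j) i κ μ‖ ^ 2 := by
        intro i
        rw [Fintype.sum_prod_type, Finset.sum_comm]
        exact Finset.sum_congr rfl fun μ _ => sum_normSq_col_twirl w (f j) i μ
      simp_rw [this]
      rw [Finset.sum_comm]
      refine Finset.sum_congr rfl fun μ _ => ?_
      rw [Finset.sum_comm]
    rw [e1]
    simp_rw [kw_spectral_identity]
    -- pointwise bound and `‖f j‖ = 1`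
    have hnorm : ∑ μ : Fin n, ∑ κ : Fin n,
        (‖f j (0, (μ, κ))‖ ^ 2 + ‖f j (1, (μ, κ))‖ ^ 2 + ‖f j (2, (μ, κ))‖ ^ 2) = 1 := by
      have h1 : ‖f j‖ ^ 2 = 1 := by rw [hf.1 j, one_pow]
      rw [EuclideanSpace.norm_sq_eq, Fintype.sum_prod_type, Fin.sum_univ_three] at h1
      simp only [Fintype.sum_prod_type] at h1
      rw [← h1, ← Finset.sum_add_distrib, ← Finset.sum_add_distrib]
      refine Finset.sum_congr rfl fun μ _ => ?_
      rw [← Finset.sum_add_distrib, ← Finset.sum_add_distrib]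
    rw [← hnorm, ← Finset.sum_add_distrib]
    refine Finset.sum_le_sum fun μ _ => ?_
    rw [← Finset.sum_add_distrib]
    exact Finset.sum_le_sum fun κ _ => kwR_le (f j) μ κ
  -- sum over `j` and Bessel
  have hB1 : ∀ (μ κ : Fin n), ∑ j, ‖⟪kwV κ μ, f j⟫_ℂ‖ ^ 2 ≤ 1 := by
    intro μ κ
    have := hf.sum_inner_products_le (kwV κ μ) (s := Finset.univ)
    rw [norm_kwV, one_pow] at this
    refine le_trans (le_of_eq (Finset.sum_congr rfl fun j _ => ?_)) this
    rw [norm_inner_symm]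
  have hB2 : ∀ r : Fin 3 × (Fin n × Fin n), ∑ j, ‖f j r‖ ^ 2 ≤ 1 := by
    intro r
    have := hf.sum_inner_products_le (EuclideanSpace.single r (1 : ℂ)) (s := Finset.univ)
    rw [PiLp.norm_single, norm_one, one_pow] at this
    refine le_trans (le_of_eq (Finset.sum_congr rfl fun j _ => ?_)) this
    rw [norm_inner_symm, EuclideanSpace.inner_single_left, map_one, one_mul]
  calc ∑ j, ∑ q : Fin 3 × (Fin n × Fin n),
        ‖∑ r : Fin 3 × (Fin n × Fin n), conj (f j r) * kwM (kwProj w) (matMulTensor ℂ n n n) r q‖ ^ 2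
      ≤ ∑ j : Fin m, (1 + ∑ μ : Fin n, ∑ κ : Fin n,
          (if κ.rev = κ then 2 * (‖f j (1, (μ, κ))‖ ^ 2 + ‖f j (2, (μ, κ))‖ ^ 2)
            else 3 * ‖⟪kwV κ μ, f j⟫_ℂ‖ ^ 2)) := Finset.sum_le_sum fun j _ => hper j
    _ = (m : ℝ) + ∑ μ : Fin n, ∑ κ : Fin n, ∑ j : Fin m,
          (if κ.rev = κ then 2 * (‖f j (1, (μ, κ))‖ ^ 2 + ‖f j (2, (μ, κ))‖ ^ 2)
            else 3 * ‖⟪kwV κ μ, f j⟫_ℂ‖ ^ 2) := by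
          rw [Finset.sum_add_distrib, Finset.sum_const, Finset.card_univ, Fintype.card_fin, nsmul_eq_mul,
            mul_one, Finset.sum_comm]
          congr 1
          exact Finset.sum_congr rfl fun μ _ => Finset.sum_comm
    _ ≤ (m : ℝ) + ∑ _μ : Fin n, ∑ κ : Fin n, (if κ.rev = κ then (4 : ℝ) else 3) := by
          gcongr with μ _ κ _
          split_ifs with h
          · rw [← Finset.mul_sum, Finset.sum_add_distrib]
            have ha := hB2 (1, (μ, κ))
            have hb := hB2 (2, (μ, κ))
            linarith
          · rw [← Finset.mul_sum]
            have := hB1 μ κ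
            linarith
    _ = (m : ℝ) + (n : ℝ) * (3 * n + (n % 2 : ℕ)) := by
          rw [Finset.sum_const, Finset.card_univ, Fintype.card_fin, nsmul_eq_mul]
          congr 1
          rw [Finset.sum_ite, Finset.sum_const, Finset.sum_const, card_filter_rev_eq]
          have hc : (Finset.univ.filter fun κ : Fin n => ¬ κ.rev = κ).card = n - n % 2 := by
            have := Finset.card_filter_add_card_filter_not (s := Finset.univ) (fun κ : Fin n => κ.rev = κ)
            rw [card_filter_rev_eq, Finset.card_univ, Fintype.card_fin] at this
            omega
          rw [hc]
          have hle : n % 2 ≤ n := Nat.mod_le n 2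
          rw [nsmul_eq_mul, nsmul_eq_mul, Nat.cast_sub hle]
          ring
    _ = (m : ℝ) + 3 * (n : ℝ) ^ 2 + (n : ℝ) * (n % 2 : ℕ) := by ring

end MatMul

end Summit.MatrixMultiplication.MatrixMultiplication.Theorems.DiagonalPowerDecay

end
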